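import Mathlib
import HarnessLib
import Summits.HubbardSuperconductivity.HubbardSuperconductivity.Theorems.KLProgrammeKLRegimeEngineV8TwoLegGridSpectator
import Summits.HubbardSuperconductivity.HubbardSuperconductivity.Theorems.KLProgrammeKLRegimeTwoVolumeSectorPreimageMap
import Literature.MathematicalPhysics.QuantumLattice.HubbardSectorAnalysisFactorisation

/-!
# Route `KLProgramme` — ENGINE child gen 8 (stmt-HubbardSuperconductivity-20437 `KLRegimeEngineV17F2`), class #7 in GRID currency ((Y′)-GRID), deliverable
# W3 «plain-leg m = 2 read-out pass»: the grid increment's plain legs as SPECTATOR legs of the TOWER'S OWN sectorised step — the vertex is the sector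
# preimage `sectorPreimage β F 𝒱⁽ʲ⁾[K]` with ≤ m legs diverted to grid pins, the covariance is the sectorised propagator `S(F̃)ᵀ C^K_{(Λ_{j+1},Λ_j]} S(F̃)`
# (cell gate-hubbard-kl, seat hubbard-kl-k3c2-p3 g7)

THE DOOR IN THE TOWER'S CURRENCY.  For a thin/fat pair `F, F̃` (`F̃F = F`) whose plateau covers the slice (`Σ_ω F_ω = 1` on the momenta of
`supp C^K_{(Λ_{j+1},Λ_j]}` — the tower's own hypothesis `hCpl` of `kernelNorm_sectorAnalysis_effAction_le_of_gramBounded_of_plateau`), the grid slice covariance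
FACTORS through the sectorised propagator along the substitution `M := (ε_x • E(F)) · S_{4M}` (`smul_sectorAnalysis_factorisation`, Literature):
`G_{j+1} = S_{4M}ᵀ C^K_{(Λ_{j+1},Λ_j]} S_{4M} = Mᵀ · (S(F̃)ᵀ C^K_{(Λ_{j+1},Λ_j]} S(F̃)) · M`.  Hence (`GrassmannSpectatorReadout`) every piece of the grid increment
`kernel_m (W_{j+1}[K] − W_j[K]) p` is the all-spectator kernel of the same piece of ONE Gaussian step in the algebra `(SpaceTimeIdx L M × SectorLeg N) ⊕ Fin m`
with covariance `fromBlocks (S(F̃)ᵀ C^K_{(Λ_{j+1},Λ_j]} S(F̃)) 0 0 0` — the tower's sectorised propagator, spectators inert — acting on the vertex `Ψ_p W_j[K]`,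
`Ψ_p = map (toLin' (fromRows M [p a = q]))`, whose SECTOR legs are those of `sectorPreimage β F 𝒱⁽ʲ⁾[K]` (k3c4-p1's `sectorPreimage_map_eq_map_mul` with
`map (toLin' S_{4M}) W_j[K] = 𝒱⁽ʲ⁾[K]`) and whose spectator legs are the plain grid legs of `W_j[K]` (≤ m of them by nilpotency): the tower's vertex `Ṽ_j` with at most
`m` legs diverted to grid pins.  So W3's analytic half = the tower's G1-L / weighted step in that algebra (Gram / decay data of the sectorised propagator; a zero
block changes neither) fed with the ANCHORED MIXED NORMS of `Ψ_p W_j[K]` — E1's «anchored mixed plain/sectorised hN» ((R59x)), now a definite object.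

* **`gridSliceCov_eq_factorisation`** — `S_{4M}ᵀ C^K_{(Λ_{j+1},Λ_j]} S_{4M} = Mᵀ (S(F̃)ᵀ C^K_{(Λ_{j+1},Λ_j]} S(F̃)) M`;
* **`kernel_gridEffAction_succ_sub_eq_spectator_sector`** — the three-piece split (p563490) with every piece in sector-spectator form (any `m`, any grid string);
* **`kernel_gridSpectatorVertexSector_inl`** — `kernel_m (Ψ_p W_j[K]) (inl ∘ k) = kernel_m (sectorPreimage β F 𝒱⁽ʲ⁾[K]) k`;
  `kernel_gridSpectatorVertexSector_inr` (spectator legs = grid legs of `W_j[K]`), `kernel_gridSpectatorVertexSector_eq_zero_of_repeat`.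

Exact identities; no estimate, no definition; nothing about the model's sizes is asserted; nothing asserts superconductivity.
References: BGM 2006 §2.2 (2.12), §2.7 (2.66)–(2.71) [cite: BenfattoGiulianiMastropietro2006]; Salmhofer 1999 App. B.2 (B.23)–(B.25) [cite: Salmhofer1999].
-/

noncomputable section

namespace Summit.HubbardSuperconductivity.HubbardSuperconductivity.Theorems.EngineV8

set_option linter.dupNamespace false -- summit = problem name (single-conjunct summit), D-0017

open Real Finset Literature.MathematicalPhysics.QuantumLattice Literature.Probability.LatticeModels
open Literature.Probability.LatticeModels.BattleFederbush GrassmannAlgebra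
open Summit.HubbardSuperconductivity.HubbardSuperconductivity.Theorems.KLRegimeSplit
open Summit.HubbardSuperconductivity.HubbardSuperconductivity.Theorems.KLProgrammeLegKernels
open Summit.HubbardSuperconductivity.HubbardSuperconductivity.Theorems.TwoVolumeDefect

section Model

variable {L M : ℕ} [NeZero L] [NeZero M] {N : ℕ}

/-- **THE GRID SLICE COVARIANCE FACTORS THROUGH THE SECTORISED PROPAGATOR** (`β ≠ 0`, `F̃F = F`, plateau of `F` over the slice):
`S_{4M}ᵀ C^K_{(Λ_{j+1},Λ_j]} S_{4M} = ((ε_x • E(F)) S_{4M})ᵀ · (S(F̃)ᵀ C^K_{(Λ_{j+1},Λ_j]} S(F̃)) · ((ε_x • E(F)) S_{4M})`. -/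
theorem gridSliceCov_eq_factorisation {β : ℝ} (hβ : β ≠ 0) (μ : ℝ) (K : TrigPolyC4v) (j : ℕ) (F Ft : Fin N → FreqMomentum L M → ℂ)
    (hFF : ∀ ω k, Ft ω k * F ω k = F ω k)
    (hCpl : ∀ X Y, hubbardCovSliceCT L M β μ 0 K (klScale klE0 (j + 1)) (klScale klE0 j) X Y ≠ 0 → ∑ ω, F ω X.1.1 = 1 ∧ ∑ ω, F ω Y.1.1 = 1) :
    (hubbardGridSub L M β (2 * (2 * M))).transpose * hubbardCovSliceCT L M β μ 0 K (klScale klE0 (j + 1)) (klScale klE0 j) *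
        hubbardGridSub L M β (2 * (2 * M)) =
      ((((imagTimeWeight β M : ℝ) : ℂ)) • sectorAnalysisMatrix L M β F * hubbardGridSub L M β (2 * (2 * M))).transpose *
        ((sectorSubMatrix L M β Ft).transpose * hubbardCovSliceCT L M β μ 0 K (klScale klE0 (j + 1)) (klScale klE0 j) * sectorSubMatrix L M β Ft) *
        ((((imagTimeWeight β M : ℝ) : ℂ)) • sectorAnalysisMatrix L M β F * hubbardGridSub L M β (2 * (2 * M))) :=
  (smul_sectorAnalysis_factorisation hβ F Ft hFF _ hCpl _).symm

/-- **THE GRID INCREMENT IN SECTOR-SPECTATOR FORM** (`β ≠ 0`, `Z^K_{Λ_j} ≠ 0`, `F̃F = F`, plateau of `F` over the slice; every degree `m`, every grid string `p`):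
with `M = (ε_x • E(F)) S_{4M}`, `D = S(F̃)ᵀ C^K_{(Λ_{j+1},Λ_j]} S(F̃)`, `B = fromBlocks D 0 0 0`, `Ψ_p = map (toLin' (fromRows M [p a = q]))`,
`kernel_m (W_{j+1}[K] − W_j[K]) p = kernel_m (Δ_B (Ψ_p W_j)) inr + kernel_m (e^{Δ_B}(Ψ_p W_j) − Ψ_p W_j − Δ_B(Ψ_p W_j)) inr + kernel_m (effAction B (Ψ_p W_j) − e^{Δ_B}(Ψ_p W_j)) inr`. -/
theorem kernel_gridEffAction_succ_sub_eq_spectator_sector {β : ℝ} (hβ : β ≠ 0) (U μ : ℝ) (K : TrigPolyC4v) (j : ℕ)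
    (hZ : hubbardEffPartitionFnCT L M β U μ 0 K (klScale klE0 j) ≠ 0) (F Ft : Fin N → FreqMomentum L M → ℂ) (hFF : ∀ ω k, Ft ω k * F ω k = F ω k)
    (hCpl : ∀ X Y, hubbardCovSliceCT L M β μ 0 K (klScale klE0 (j + 1)) (klScale klE0 j) X Y ≠ 0 → ∑ ω, F ω X.1.1 = 1 ∧ ∑ ω, F ω Y.1.1 = 1)
    (m : ℕ) (p : Fin m → GridLeg (GridPoint L (2 * (2 * M)))) :
    kernel ℂ
        (effAction ℂ ((hubbardGridSub L M β (2 * (2 * M))).transpose *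
            hubbardCovAboveCT L M β μ 0 K (klScale klE0 (j + 1)) * hubbardGridSub L M β (2 * (2 * M)))
          (hubbardGridInteraction L (2 * (2 * M)) β U + hubbardGridCounterQuadratic L (2 * (2 * M)) β K) -
        effAction ℂ ((hubbardGridSub L M β (2 * (2 * M))).transpose *
            hubbardCovAboveCT L M β μ 0 K (klScale klE0 j) * hubbardGridSub L M β (2 * (2 * M)))
          (hubbardGridInteraction L (2 * (2 * M)) β U + hubbardGridCounterQuadratic L (2 * (2 * M)) β K)) m p =
      kernel ℂ (grassmannLaplacian ℂ
          (Matrix.fromBlocks ((sectorSubMatrix L M β Ft).transpose * hubbardCovSliceCT L M β μ 0 K (klScale klE0 (j + 1)) (klScale klE0 j) *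
              sectorSubMatrix L M β Ft) (0 : Matrix (SpaceTimeIdx L M × SectorLeg N) (Fin m) ℂ)
            (0 : Matrix (Fin m) (SpaceTimeIdx L M × SectorLeg N) ℂ) (0 : Matrix (Fin m) (Fin m) ℂ))
          (ExteriorAlgebra.map (Matrix.toLin' (Matrix.fromRows
              ((((imagTimeWeight β M : ℝ) : ℂ)) • sectorAnalysisMatrix L M β F * hubbardGridSub L M β (2 * (2 * M)))
              (Matrix.of fun b q => if p b = q then (1 : ℂ) else 0)))
            (effAction ℂ ((hubbardGridSub L M β (2 * (2 * M))).transpose *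
                hubbardCovAboveCT L M β μ 0 K (klScale klE0 j) * hubbardGridSub L M β (2 * (2 * M)))
              (hubbardGridInteraction L (2 * (2 * M)) β U + hubbardGridCounterQuadratic L (2 * (2 * M)) β K)))) m Sum.inr +
      kernel ℂ (gaussConv ℂ
            (Matrix.fromBlocks ((sectorSubMatrix L M β Ft).transpose * hubbardCovSliceCT L M β μ 0 K (klScale klE0 (j + 1)) (klScale klE0 j) *
                sectorSubMatrix L M β Ft) (0 : Matrix (SpaceTimeIdx L M × SectorLeg N) (Fin m) ℂ)
              (0 : Matrix (Fin m) (SpaceTimeIdx L M × SectorLeg N) ℂ) (0 : Matrix (Fin m) (Fin m) ℂ))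
            (ExteriorAlgebra.map (Matrix.toLin' (Matrix.fromRows
                ((((imagTimeWeight β M : ℝ) : ℂ)) • sectorAnalysisMatrix L M β F * hubbardGridSub L M β (2 * (2 * M)))
                (Matrix.of fun b q => if p b = q then (1 : ℂ) else 0)))
              (effAction ℂ ((hubbardGridSub L M β (2 * (2 * M))).transpose *
                  hubbardCovAboveCT L M β μ 0 K (klScale klE0 j) * hubbardGridSub L M β (2 * (2 * M)))
                (hubbardGridInteraction L (2 * (2 * M)) β U + hubbardGridCounterQuadratic L (2 * (2 * M)) β K))) -
          ExteriorAlgebra.map (Matrix.toLin' (Matrix.fromRows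
              ((((imagTimeWeight β M : ℝ) : ℂ)) • sectorAnalysisMatrix L M β F * hubbardGridSub L M β (2 * (2 * M)))
              (Matrix.of fun b q => if p b = q then (1 : ℂ) else 0)))
            (effAction ℂ ((hubbardGridSub L M β (2 * (2 * M))).transpose *
                hubbardCovAboveCT L M β μ 0 K (klScale klE0 j) * hubbardGridSub L M β (2 * (2 * M)))
              (hubbardGridInteraction L (2 * (2 * M)) β U + hubbardGridCounterQuadratic L (2 * (2 * M)) β K)) -
          grassmannLaplacian ℂ
            (Matrix.fromBlocks ((sectorSubMatrix L M β Ft).transpose * hubbardCovSliceCT L M β μ 0 K (klScale klE0 (j + 1)) (klScale klE0 j) *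
                sectorSubMatrix L M β Ft) (0 : Matrix (SpaceTimeIdx L M × SectorLeg N) (Fin m) ℂ)
              (0 : Matrix (Fin m) (SpaceTimeIdx L M × SectorLeg N) ℂ) (0 : Matrix (Fin m) (Fin m) ℂ))
            (ExteriorAlgebra.map (Matrix.toLin' (Matrix.fromRows
                ((((imagTimeWeight β M : ℝ) : ℂ)) • sectorAnalysisMatrix L M β F * hubbardGridSub L M β (2 * (2 * M)))
                (Matrix.of fun b q => if p b = q then (1 : ℂ) else 0)))
              (effAction ℂ ((hubbardGridSub L M β (2 * (2 * M))).transpose *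
                  hubbardCovAboveCT L M β μ 0 K (klScale klE0 j) * hubbardGridSub L M β (2 * (2 * M)))
                (hubbardGridInteraction L (2 * (2 * M)) β U + hubbardGridCounterQuadratic L (2 * (2 * M)) β K)))) m Sum.inr +
      kernel ℂ (effAction ℂ
            (Matrix.fromBlocks ((sectorSubMatrix L M β Ft).transpose * hubbardCovSliceCT L M β μ 0 K (klScale klE0 (j + 1)) (klScale klE0 j) *
                sectorSubMatrix L M β Ft) (0 : Matrix (SpaceTimeIdx L M × SectorLeg N) (Fin m) ℂ)
              (0 : Matrix (Fin m) (SpaceTimeIdx L M × SectorLeg N) ℂ) (0 : Matrix (Fin m) (Fin m) ℂ))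
            (ExteriorAlgebra.map (Matrix.toLin' (Matrix.fromRows
                ((((imagTimeWeight β M : ℝ) : ℂ)) • sectorAnalysisMatrix L M β F * hubbardGridSub L M β (2 * (2 * M)))
                (Matrix.of fun b q => if p b = q then (1 : ℂ) else 0)))
              (effAction ℂ ((hubbardGridSub L M β (2 * (2 * M))).transpose *
                  hubbardCovAboveCT L M β μ 0 K (klScale klE0 j) * hubbardGridSub L M β (2 * (2 * M)))
                (hubbardGridInteraction L (2 * (2 * M)) β U + hubbardGridCounterQuadratic L (2 * (2 * M)) β K))) -
          gaussConv ℂ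
            (Matrix.fromBlocks ((sectorSubMatrix L M β Ft).transpose * hubbardCovSliceCT L M β μ 0 K (klScale klE0 (j + 1)) (klScale klE0 j) *
                sectorSubMatrix L M β Ft) (0 : Matrix (SpaceTimeIdx L M × SectorLeg N) (Fin m) ℂ)
              (0 : Matrix (Fin m) (SpaceTimeIdx L M × SectorLeg N) ℂ) (0 : Matrix (Fin m) (Fin m) ℂ))
            (ExteriorAlgebra.map (Matrix.toLin' (Matrix.fromRows
                ((((imagTimeWeight β M : ℝ) : ℂ)) • sectorAnalysisMatrix L M β F * hubbardGridSub L M β (2 * (2 * M)))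
                (Matrix.of fun b q => if p b = q then (1 : ℂ) else 0)))
              (effAction ℂ ((hubbardGridSub L M β (2 * (2 * M))).transpose *
                  hubbardCovAboveCT L M β μ 0 K (klScale klE0 j) * hubbardGridSub L M β (2 * (2 * M)))
                (hubbardGridInteraction L (2 * (2 * M)) β U + hubbardGridCounterQuadratic L (2 * (2 * M)) β K)))) m Sum.inr := by
  set Mb := (((imagTimeWeight β M : ℝ) : ℂ)) • sectorAnalysisMatrix L M β F * hubbardGridSub L M β (2 * (2 * M)) with hMb
  set D := (sectorSubMatrix L M β Ft).transpose * hubbardCovSliceCT L M β μ 0 K (klScale klE0 (j + 1)) (klScale klE0 j) * sectorSubMatrix L M β Ft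
    with hD
  set W := effAction ℂ ((hubbardGridSub L M β (2 * (2 * M))).transpose *
      hubbardCovAboveCT L M β μ 0 K (klScale klE0 j) * hubbardGridSub L M β (2 * (2 * M)))
    (hubbardGridInteraction L (2 * (2 * M)) β U + hubbardGridCounterQuadratic L (2 * (2 * M)) β K) with hW
  have hfac : (hubbardGridSub L M β (2 * (2 * M))).transpose * hubbardCovSliceCT L M β μ 0 K (klScale klE0 (j + 1)) (klScale klE0 j) *
      hubbardGridSub L M β (2 * (2 * M)) = Mb.transpose * D * Mb := by
    rw [hMb, hD]; exact gridSliceCov_eq_factorisation hβ μ K j F Ft hFF hCpl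
  have h1 := kernel_grassmannLaplacian_eq_spectator ℂ Mb D p W m id
  have h2 := kernel_gaussConv_sub_sub_laplacian_eq_spectator ℂ Mb D p W m id
  have h3 := kernel_effAction_sub_gaussConv_eq_spectator ℂ Mb D p W m id
  rw [Function.comp_id, Function.comp_id] at h1 h2 h3
  rw [kernel_gridEffAction_succ_sub_eq hβ U μ K j hZ m p, ← hW, hfac, h1, h2, h3]

/-- **THE SECTOR LEGS OF THE SPECTATOR VERTEX ARE THOSE OF THE TOWER'S PREIMAGE `sectorPreimage β F 𝒱⁽ʲ⁾[K]`** (`β ≠ 0`; every `m`, every grid pin family `p`,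
every sector string `k`): `kernel_m (Ψ_p W_j[K]) (inl ∘ k) = kernel_m (sectorPreimage β F (klEffectiveAction L M β U μ K klE0 j)) k`. -/
theorem kernel_gridSpectatorVertexSector_inl {β : ℝ} (hβ : β ≠ 0) (U μ : ℝ) (K : TrigPolyC4v) (j : ℕ) (F : Fin N → FreqMomentum L M → ℂ) {r : ℕ}
    (p : Fin r → GridLeg (GridPoint L (2 * (2 * M)))) (m : ℕ) (k : Fin m → SpaceTimeIdx L M × SectorLeg N) :
    kernel ℂ (ExteriorAlgebra.map (Matrix.toLin' (Matrix.fromRows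
          ((((imagTimeWeight β M : ℝ) : ℂ)) • sectorAnalysisMatrix L M β F * hubbardGridSub L M β (2 * (2 * M)))
          (Matrix.of fun b q => if p b = q then (1 : ℂ) else 0)))
        (effAction ℂ ((hubbardGridSub L M β (2 * (2 * M))).transpose *
            hubbardCovAboveCT L M β μ 0 K (klScale klE0 j) * hubbardGridSub L M β (2 * (2 * M)))
          (hubbardGridInteraction L (2 * (2 * M)) β U + hubbardGridCounterQuadratic L (2 * (2 * M)) β K))) m (Sum.inl ∘ k) =
      kernel ℂ (sectorPreimage β F (klEffectiveAction L M β U μ K klE0 j)) m k := by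
  haveI : NeZero (2 * (2 * M) : ℕ) := ⟨by have := NeZero.ne M; omega⟩
  rw [kernel_map_fromRows_inl, klEffectiveAction_eq_map_hubbardGridSub (N := 2 * (2 * M)) hβ U μ K klE0 j (by omega) (by omega),
    sectorPreimage_map_eq_map_mul]

omit [NeZero M] in
/-- **The spectator legs of the sector spectator vertex are the grid legs of `W_j[K]`**: `kernel_m (Ψ_p W_j[K]) (inr ∘ a) = kernel_m (W_j[K]) (p ∘ a)`. -/
theorem kernel_gridSpectatorVertexSector_inr (β U μ : ℝ) (K : TrigPolyC4v) (j : ℕ) (F : Fin N → FreqMomentum L M → ℂ) {r : ℕ}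
    (p : Fin r → GridLeg (GridPoint L (2 * (2 * M)))) (m : ℕ) (a : Fin m → Fin r) :
    kernel ℂ (ExteriorAlgebra.map (Matrix.toLin' (Matrix.fromRows
          ((((imagTimeWeight β M : ℝ) : ℂ)) • sectorAnalysisMatrix L M β F * hubbardGridSub L M β (2 * (2 * M)))
          (Matrix.of fun b q => if p b = q then (1 : ℂ) else 0)))
        (effAction ℂ ((hubbardGridSub L M β (2 * (2 * M))).transpose *
            hubbardCovAboveCT L M β μ 0 K (klScale klE0 j) * hubbardGridSub L M β (2 * (2 * M)))
          (hubbardGridInteraction L (2 * (2 * M)) β U + hubbardGridCounterQuadratic L (2 * (2 * M)) β K))) m (Sum.inr ∘ a) =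
      kernel ℂ (effAction ℂ ((hubbardGridSub L M β (2 * (2 * M))).transpose *
            hubbardCovAboveCT L M β μ 0 K (klScale klE0 j) * hubbardGridSub L M β (2 * (2 * M)))
          (hubbardGridInteraction L (2 * (2 * M)) β U + hubbardGridCounterQuadratic L (2 * (2 * M)) β K)) m (p ∘ a) :=
  kernel_map_fromRows_spectator_inr ℂ _ p _ m a

omit [NeZero M] in
/-- **No kernel of the sector spectator vertex carries a grid pin twice** (`θ_a² = 0`): with `r = 2` pins at most two plain grid legs occur. -/
theorem kernel_gridSpectatorVertexSector_eq_zero_of_repeat (β U μ : ℝ) (K : TrigPolyC4v) (j : ℕ) (F : Fin N → FreqMomentum L M → ℂ) {r : ℕ}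
    (p : Fin r → GridLeg (GridPoint L (2 * (2 * M)))) (m : ℕ) (Z : Fin m → (SpaceTimeIdx L M × SectorLeg N) ⊕ Fin r) {i i' : Fin m} (hii' : i ≠ i')
    {b : Fin r} (hi : Z i = Sum.inr b) (hi' : Z i' = Sum.inr b) :
    kernel ℂ (ExteriorAlgebra.map (Matrix.toLin' (Matrix.fromRows
          ((((imagTimeWeight β M : ℝ) : ℂ)) • sectorAnalysisMatrix L M β F * hubbardGridSub L M β (2 * (2 * M)))
          (Matrix.of fun b q => if p b = q then (1 : ℂ) else 0)))
        (effAction ℂ ((hubbardGridSub L M β (2 * (2 * M))).transpose *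
            hubbardCovAboveCT L M β μ 0 K (klScale klE0 j) * hubbardGridSub L M β (2 * (2 * M)))
          (hubbardGridInteraction L (2 * (2 * M)) β U + hubbardGridCounterQuadratic L (2 * (2 * M)) β K))) m Z = 0 :=
  kernel_map_fromRows_eq_zero_of_spectator_repeat ℂ _ p _ m Z hii' hi hi'

end Model

end Summit.HubbardSuperconductivity.HubbardSuperconductivity.Theorems.EngineV8

end
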